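import Summits.ResolutionOfSingularities.ResolutionOfSingularities.Theses.CleanCovers
import Literature.AlgebraicGeometry.Resolution.NonReducedNoResolution
import Literature.AlgebraicGeometry.Resolution.PrincipalizationToResolution
import Literature.AlgebraicGeometry.Resolution.ProjectiveSpaceRegular
import Summits.ResolutionOfSingularities.ResolutionOfSingularities.Theorems.CoverResolution.Negative.FalseWithoutIsFiniteTools

/-!
# `CoverResolution` — negative lemmas III: `IsFinite f` is load-bearing (the pinch witness)

Support (negative) lemma for crux `stmt-ResolutionOfSingularities-15104`
(`Summit.ResolutionOfSingularities.ResolutionOfSingularities.Theses.CleanCovers.CoverResolution`: every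
INTEGRAL `X` with a FINITE SURJECTIVE `f : X → ℙⁿ_k`, `k` perfect of characteristic `p`, ÉTALE over the
chart `D₊(xₙ)`, has a resolution), filed by the standing disprover (cdisprove cycle 1; work file
`Cruxes/CoverResolution/Disproof.lean`, §4, which carries the commented construction with named
definitions). `coverResolution_false_without_isFinite`: the crux with `IsFinite f` deleted is FALSE
in dimension `n = 2`. This file declares NO definition — the data of the witness is written with
file-local notation — and NO declaration concludes the route decl positively; the generic tools
(no resolution without Noetherianity; gluing a non-resolvable piece) are in
`Negative/FalseWithoutIsFiniteTools.lean`.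

The witness. In the chart `D₊(x₀) = Spec k[y₀,y₁]` of `ℙ²_k` (`y₀ = x₁/x₀`, `y₁ = x₂/x₀`; the
hyperplane at infinity `V₊(x₂)` is `y₁ = 0`) let `A = k[y₀,y₁,y₁⁻¹]` (`Spec A = D₊(x₀x₂)`) and let
`O := {a ∈ A : a(0,y₁) ∈ k[y₀,y₁]} = k[y₁] + y₀·A` — the PINCH RING, realised as the preimage of
`k[y₀,y₁] ⊆ A` under the endomorphism `ε : A → A`, `y₀ ↦ 0`: a (non-Noetherian, integrally closed)
domain with `O[1/y₁] = A` in which `u = y₀ ≠ 0` is divisible by every power of the non-unit `v = y₁`.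
Glue `X := ℙ²_k ∪ Spec O` along `Spec A` and map it to `ℙ²_k` by `𝟙 ∪ (Spec O → Spec k[y₀,y₁] =
D₊(x₀))`: `X` is integral, `f` surjective and an open immersion over `D₊(x₂)` (a prime of `O` over
`D₊(x₂)` avoids `v`, i.e. lies in `D(v) = Spec A ⊆ ℙ²_k`), and `X` has no resolution since `Spec O` has
none. Moral for provers: finiteness of `f` is used only through local Noetherianity / finite type of
`X` over the hyperplane at infinity, and only from dimension `2` on (for `n ≤ 1` the statement
without finiteness is still true, by Krull–Akizuki).

## Sources
* The Stacks Project, Tags 01RN, 02IS, 01JA; R. Hartshorne, *Algebraic Geometry*, II Prop. 2.5 (charts).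
* H. Matsumura, *Commutative Ring Theory*, Thm. 8.10 (Krull), Thm. 14.3.
-/

noncomputable section

set_option linter.dupNamespace false -- mandated namespace of this single-conjunct summit

open CategoryTheory CategoryTheory.Limits AlgebraicGeometry
open Literature.AlgebraicGeometry.Resolution Literature.AlgebraicGeometry.Motives

namespace Summit.ResolutionOfSingularities.ResolutionOfSingularities.Theorems.CoverResolution.Negative

/-! ## The pinch ring `O = k[y₁] + y₀·k[y₀,y₁,y₁⁻¹]` (no definitions: the data is local notation) -/

section PinchRing

set_option quotPrecheck false

variable (k : Type) [Field k]

local notation "𝓡" => MvPolynomial (Fin 2) k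
local notation "𝓐" => Localization.Away (MvPolynomial.X 1 : MvPolynomial (Fin 2) k)
/-- the substitution `y₀ ↦ 0`, `y₁ ↦ y₁` -/
local notation "𝓚" => (MvPolynomial.aeval (R := k)
  (Fin.cons (0 : MvPolynomial (Fin 2) k) fun _ : Fin 1 => (MvPolynomial.X 1 : MvPolynomial (Fin 2) k)) :
    MvPolynomial (Fin 2) k →ₐ[k] MvPolynomial (Fin 2) k)

/-- `y₁ ≠ 0`. [folklore] -/
theorem pinch_powers_le :
    Submonoid.powers (MvPolynomial.X 1 : 𝓡) ≤ nonZeroDivisors 𝓡 :=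
  powers_le_nonZeroDivisors_of_noZeroDivisors (MvPolynomial.X_ne_zero _)

/-- `A = k[y₀,y₁,y₁⁻¹]` is a domain. [folklore] -/
theorem isDomain_pinchA : IsDomain 𝓐 := IsLocalization.isDomain_localization (pinch_powers_le k)

attribute [local instance] isDomain_pinchA

/-- `k[y₀,y₁] → A` is injective. [folklore] -/
theorem pinch_algebraMap_injective : Function.Injective (algebraMap 𝓡 𝓐) :=
  IsLocalization.injective 𝓐 (pinch_powers_le k)

/-- `𝓚 y₀ = 0`. [folklore] -/
theorem pinchKill_X_zero : 𝓚 (MvPolynomial.X 0) = 0 := by simp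

/-- `𝓚 y₁ = y₁`. [folklore] -/
theorem pinchKill_X_one : 𝓚 (MvPolynomial.X 1) = MvPolynomial.X 1 := by
  rw [MvPolynomial.aeval_X]
  exact Fin.cons_succ (α := fun _ : Fin 2 => MvPolynomial (Fin 2) k) 0 (fun _ => MvPolynomial.X 1) 0

/-- `𝓚 y₁` is a unit of `A` (so `𝓚` extends to `A`). [folklore] -/
theorem pinch_isUnit :
    IsUnit ((RingHom.comp (algebraMap 𝓡 𝓐) (AlgHom.toRingHom 𝓚)) (MvPolynomial.X 1)) := by
  simpa [pinchKill_X_one] using IsLocalization.Away.algebraMap_isUnit (S := 𝓐) (MvPolynomial.X 1 : 𝓡)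

/-- the endomorphism `ε : A → A`, `y₀ ↦ 0` -/
local notation "𝓔" => (IsLocalization.Away.lift (S := 𝓐) (MvPolynomial.X 1 : 𝓡)
  (g := RingHom.comp (algebraMap 𝓡 𝓐) (AlgHom.toRingHom 𝓚)) (pinch_isUnit k) : 𝓐 →+* 𝓐)

/-- `ε` extends `𝓚`. [folklore] -/
theorem pinchε_algebraMap (r : 𝓡) : 𝓔 (algebraMap 𝓡 𝓐 r) = algebraMap 𝓡 𝓐 (𝓚 r) :=
  IsLocalization.Away.lift_eq _ _ r

/-- **the pinch ring** `O = ε⁻¹(k[y₀,y₁]) = k[y₁] + y₀·A` -/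
local notation "𝓞" => (Subring.comap 𝓔 (RingHom.range (algebraMap 𝓡 𝓐)) : Subring 𝓐)

/-- `k[y₀,y₁] ⊆ O`. [folklore] -/
theorem algebraMap_mem_pinch (r : 𝓡) : algebraMap 𝓡 𝓐 r ∈ 𝓞 :=
  Subring.mem_comap.mpr ⟨𝓚 r, (pinchε_algebraMap k r).symm⟩

/-- `u = y₀ ∈ O` -/
local notation "𝓾" =>
  (Subtype.mk (algebraMap 𝓡 𝓐 (MvPolynomial.X 0)) (algebraMap_mem_pinch k (MvPolynomial.X 0)) : ↥𝓞)
/-- `v = y₁ ∈ O` -/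
local notation "𝓿" =>
  (Subtype.mk (algebraMap 𝓡 𝓐 (MvPolynomial.X 1)) (algebraMap_mem_pinch k (MvPolynomial.X 1)) : ↥𝓞)

/-- `u ≠ 0`. [folklore] -/
theorem pinch_u_ne_zero : 𝓾 ≠ 0 := by
  intro h
  have h' : algebraMap 𝓡 𝓐 (MvPolynomial.X 0) = 0 := congrArg Subtype.val h
  exact MvPolynomial.X_ne_zero (0 : Fin 2)
    (pinch_algebraMap_injective k (h'.trans (map_zero _).symm))

/-- `v` is a unit of `A`. [folklore] -/
theorem pinch_isUnit_val_v : IsUnit ((𝓿 : ↥𝓞) : 𝓐) :=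
  IsLocalization.Away.algebraMap_isUnit (MvPolynomial.X 1 : 𝓡)

/-- `v` is NOT a unit of `O`: an inverse `o` would have `ε o = y₁⁻¹ ∈ k[y₀,y₁]`. [folklore] -/
theorem pinch_not_isUnit_v : ¬ IsUnit 𝓿 := by
  rintro hunit
  obtain ⟨o, ho⟩ := isUnit_iff_exists_inv.mp hunit
  have hoA : (algebraMap 𝓡 𝓐 (MvPolynomial.X 1)) * (o : 𝓐) = 1 := by
    have h := congrArg Subtype.val ho
    rw [Subring.coe_mul, OneMemClass.coe_one] at h
    exact h
  obtain ⟨r, hr⟩ := Subring.mem_comap.mp o.2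
  have hε := congrArg 𝓔 hoA
  rw [map_mul, map_one, pinchε_algebraMap, pinchKill_X_one, ← hr, ← map_mul, ← map_one
    (algebraMap 𝓡 𝓐)] at hε
  have h1 : (MvPolynomial.X 1 : 𝓡) * r = 1 := pinch_algebraMap_injective k hε
  have h2 := congrArg (MvPolynomial.eval fun _ => (0 : k)) h1
  simp at h2

/-- `u = vⁿ · (y₀ y₁⁻ⁿ)` in `O`: `u` is divisible by every power of `v`. [folklore] -/
theorem pinch_v_pow_dvd_u (n : ℕ) : 𝓿 ^ n ∣ 𝓾 := by
  let w : 𝓐 := algebraMap 𝓡 𝓐 (MvPolynomial.X 0) *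
    IsLocalization.Away.invSelf (S := 𝓐) (MvPolynomial.X 1 : 𝓡) ^ n
  have hw : w ∈ 𝓞 := by
    rw [Subring.mem_comap, map_mul, pinchε_algebraMap, pinchKill_X_zero, map_zero, zero_mul]
    exact ⟨0, map_zero _⟩
  refine ⟨⟨w, hw⟩, Subtype.ext ?_⟩
  change algebraMap 𝓡 𝓐 (MvPolynomial.X 0) =
    (algebraMap 𝓡 𝓐 (MvPolynomial.X 1)) ^ n * (algebraMap 𝓡 𝓐 (MvPolynomial.X 0) *
      IsLocalization.Away.invSelf (S := 𝓐) (MvPolynomial.X 1 : 𝓡) ^ n)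
  rw [mul_left_comm, ← mul_pow, IsLocalization.Away.mul_invSelf, one_pow, mul_one]

/-- `A = O[1/v]`. [folklore] -/
theorem isLocalization_pinch : IsLocalization.Away 𝓿 𝓐 := by
  refine IsLocalization.Away.mk 𝓿 (pinch_isUnit_val_v k) (fun s => ?_) (fun a b hab => ⟨0, ?_⟩)
  · obtain ⟨n, a, h⟩ := IsLocalization.Away.surj (MvPolynomial.X 1 : 𝓡) s
    exact ⟨n, ⟨algebraMap 𝓡 𝓐 a, algebraMap_mem_pinch k a⟩, h⟩
  · have : (a : 𝓐) = b := hab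
    rw [pow_zero, one_mul, one_mul]
    exact Subtype.ext this

/-- **`Spec O` has no resolution** (the affine core applied to the pinch ring). [folklore] -/
theorem not_hasResolution_Spec_pinch : ¬ Scheme.HasResolution (Spec (.of ↥𝓞)) :=
  not_hasResolution_Spec_of_forall_pow_dvd 𝓾 𝓿 (pinch_u_ne_zero k) (pinch_not_isUnit_v k)
    (pinch_v_pow_dvd_u k)


/-! ### `Spec O` is integral, `Spec A` is non-empty -/

/-- `Spec O` is an integral scheme. [folklore] -/
theorem isIntegral_Spec_pinch : IsIntegral (Spec (.of ↥𝓞)) := (affine_isIntegral_iff _).mpr inferInstance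

/-- `Spec A` is non-empty. [folklore] -/
theorem nonempty_Spec_pinchA : Nonempty ↥(Spec (CommRingCat.of 𝓐)) :=
  inferInstanceAs (Nonempty (PrimeSpectrum 𝓐))

/-! ### The chart `D₊(x₀) = Spec k[y₀,y₁] ⊆ ℙ²_k` and the maps `g`, `j₂` -/

attribute [local instance] MvPolynomial.gradedAlgebra ProjBaseChange.algebraBase
  ProjBaseChange.isScalarTower_localization

/-- the chart ring map `k[y₀,y₁] → O` -/
local notation "𝓹" => (RingHom.codRestrict (algebraMap 𝓡 𝓐) 𝓞 (algebraMap_mem_pinch k) : 𝓡 →+* ↥𝓞)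
/-- `ℙ²_k` -/
local notation "𝓟" => (Comma.left (projectiveSpace 2 k) : Scheme.{0})
/-- the chart `Spec k[y₀,y₁] ≅ Spec (k[x]_{x₀})₀ = D₊(x₀) ↪ ℙ²_k` (`y₀ = x₁/x₀`, `y₁ = x₂/x₀`) -/
local notation "𝓒" => (Spec.map (Iso.hom (RingEquiv.toCommRingCatIso (AlgEquiv.toRingEquiv
    (ProjectiveSpace.chartAlgEquiv k (0 : Fin (2 + 1)))))) ≫
  Proj.awayι (MvPolynomial.homogeneousSubmodule (Fin (2 + 1)) k) (MvPolynomial.X 0)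
    (ProjectiveSpace.X_mem 0) zero_lt_one : Spec (CommRingCat.of 𝓡) ⟶ 𝓟)
/-- `g : Spec O → Spec k[y₀,y₁] → ℙ²_k` -/
local notation "𝓰" => (Spec.map (CommRingCat.ofHom 𝓹) ≫ 𝓒 : Spec (CommRingCat.of ↥𝓞) ⟶ 𝓟)
/-- `j₂ : Spec A = D(v) ↪ Spec O` -/
local notation "𝓳₂" =>
  (Spec.map (CommRingCat.ofHom (algebraMap ↥𝓞 𝓐)) : Spec (CommRingCat.of 𝓐) ⟶ Spec (CommRingCat.of ↥𝓞))

/-- The chart is an open immersion. [folklore] -/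
theorem isOpenImmersion_pinchChart : IsOpenImmersion 𝓒 := by
  let e := (ProjectiveSpace.chartAlgEquiv k (0 : Fin (2 + 1))).toRingEquiv.toCommRingCatIso
  haveI : IsIso (Spec.map e.hom) :=
    ⟨⟨Spec.map e.inv, by rw [← Spec.map_comp, e.inv_hom_id, Spec.map_id],
      by rw [← Spec.map_comp, e.hom_inv_id, Spec.map_id]⟩⟩
  haveI h2 : IsOpenImmersion (Proj.awayι (MvPolynomial.homogeneousSubmodule (Fin (2 + 1)) k)
      (MvPolynomial.X 0) (ProjectiveSpace.X_mem 0) zero_lt_one) := by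
    rw [← Proj.basicOpenIsoSpec_inv_ι]
    exact IsOpenImmersion.comp _ _
  exact @IsOpenImmersion.comp _ _ _ (Spec.map e.hom) _ inferInstance h2

/-- `j₂` is an open immersion (`A = O[1/v]`). [folklore] -/
theorem isOpenImmersion_pinchj₂ : IsOpenImmersion 𝓳₂ := by
  haveI := isLocalization_pinch k
  exact IsOpenImmersion.of_isLocalization 𝓿

/-- `j₁ := j₂ ≫ g = (Spec A → Spec k[y₀,y₁]) ≫ chart` is an open immersion. [folklore] -/
theorem isOpenImmersion_pinchj₁ : IsOpenImmersion (𝓳₂ ≫ 𝓰) := by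
  have heq : 𝓳₂ ≫ 𝓰 = Spec.map (CommRingCat.ofHom (algebraMap 𝓡 𝓐)) ≫ 𝓒 := by
    simp only [← Category.assoc, ← Spec.map_comp]
    rfl
  rw [heq]
  haveI : IsOpenImmersion (Spec.map (CommRingCat.ofHom (algebraMap 𝓡 𝓐))) :=
    IsOpenImmersion.of_isLocalization (MvPolynomial.X 1 : 𝓡)
  haveI := isOpenImmersion_pinchChart k
  infer_instance

/-- Points of `Spec O` that `g` maps into the chart `D₊(x₂)` lie in `D(v)`: under the chart
`x₂/x₀ ↦ y₁ ↦ v`. [folklore] -/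
theorem pinch_v_not_mem_of_g_mem {q : ↥(Spec (CommRingCat.of ↥𝓞))}
    (hq : 𝓰 q ∈ Proj.basicOpen (MvPolynomial.homogeneousSubmodule (Fin (2 + 1)) k)
      (MvPolynomial.X 2)) : ((𝓿 : ↥𝓞)) ∉ q.asIdeal := by
  have key := Proj.awayι_preimage_basicOpen (MvPolynomial.homogeneousSubmodule (Fin (2 + 1)) k)
    (ProjectiveSpace.X_mem (0 : Fin (2 + 1))) zero_lt_one (ProjectiveSpace.X_mem (2 : Fin (2 + 1)))
    zero_lt_one
  let e := (ProjectiveSpace.chartAlgEquiv k (0 : Fin (2 + 1))).toRingEquiv.toCommRingCatIso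
  have h1 : Spec.map e.hom (Spec.map (CommRingCat.ofHom 𝓹) q) ∈
      Proj.awayι (MvPolynomial.homogeneousSubmodule (Fin (2 + 1)) k) (MvPolynomial.X 0)
        (ProjectiveSpace.X_mem 0) zero_lt_one ⁻¹ᵁ
        Proj.basicOpen (MvPolynomial.homogeneousSubmodule (Fin (2 + 1)) k) (MvPolynomial.X 2) := hq
  rw [key] at h1
  have h2 : 𝓹 (ProjectiveSpace.chartAlgEquiv k (0 : Fin (2 + 1))
      (HomogeneousLocalization.Away.isLocalizationElem (ProjectiveSpace.X_mem (0 : Fin (2 + 1)))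
        (ProjectiveSpace.X_mem (2 : Fin (2 + 1))))) ∉ q.asIdeal := h1
  have helem : ProjectiveSpace.chartAlgEquiv k (0 : Fin (2 + 1))
      (HomogeneousLocalization.Away.isLocalizationElem (ProjectiveSpace.X_mem (0 : Fin (2 + 1)))
        (ProjectiveSpace.X_mem (2 : Fin (2 + 1)))) = MvPolynomial.X 1 := by
    show ProjectiveSpace.ofChartRingHom k (0 : Fin (2 + 1)) _ = _
    rw [ProjectiveSpace.ofChartRingHom_mk]
    have h22 : (2 : Fin (2 + 1)) = Fin.succAbove 0 1 := by decide
    rw [pow_one, h22, ProjectiveSpace.dehomogenize_X_succAbove]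
  rw [helem] at h2
  exact h2

/-- Hence `g⁻¹(D₊(x₂)) ⊆ j₂(Spec A)` (`j₂(Spec A) = D(v)`). [folklore] -/
theorem pinch_preimage_chart_subset_range (q : ↥(Spec (CommRingCat.of ↥𝓞)))
    (hq : 𝓰 q ∈ Proj.basicOpen (MvPolynomial.homogeneousSubmodule (Fin (2 + 1)) k)
      (MvPolynomial.X (Fin.last 2))) : q ∈ Set.range 𝓳₂ := by
  haveI := isLocalization_pinch k
  have hv := pinch_v_not_mem_of_g_mem k hq
  have hq' : q ∈ Set.range (PrimeSpectrum.comap (algebraMap ↥𝓞 𝓐)) := by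
    rw [PrimeSpectrum.localization_away_comap_range 𝓐 𝓿]
    exact hv
  exact hq'

/-- The gluing datum: `j₁ := j₂ ≫ g` (by definition). [folklore] -/
theorem pinch_hj : 𝓳₂ ≫ 𝓰 = 𝓳₂ ≫ 𝓰 := rfl

end PinchRing

/-- **`IsFinite f` is load-bearing in `CoverResolution` (dimension `2`): the crux with the finiteness
hypothesis deleted is FALSE.** Witness: `p = 2`, `k = 𝔽₂`, `n = 2`, `X = ℙ²_k ∪ Spec O` glued along
`Spec A` (`A = k[y₀,y₁,y₁⁻¹]`: `Spec A = D₊(x₀x₂) ⊆ ℙ²_k`, `Spec A = D(v) ⊆ Spec O`), where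
`O = {a ∈ A : a(0,y₁) ∈ k[y₀,y₁]} = k[y₁] + y₀·A` is the pinch ring, and `f = 𝟙 ∪ (Spec O → Spec k[y₀,y₁]
= D₊(x₀))` (`exists_glued_of_not_hasResolution`). Then `X` is integral, `f` is surjective and an open
immersion — a fortiori étale — over `D₊(x₂)`, but `X` has no resolution, because its open piece
`Spec O` has none (`not_hasResolution_Spec_of_forall_pow_dvd`: `u = y₀ ≠ 0` is divisible by every
power of the non-unit `v = y₁`). `f` is not finite — not even of finite type — over `[1:0:0]`. In
dimension `n ≤ 1` finiteness is NOT load-bearing (Krull–Akizuki; work file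
`Cruxes/CoverResolution/Disproof.lean`, item 4): any Lean witness must live in dimension `≥ 2`.
[folklore] -/
theorem coverResolution_false_without_isFinite :
    ¬ (∀ p : ℕ, p.Prime → ∀ (k : Type) [Field k] [CharP k p] [PerfectField k] (n : ℕ)
        (X : AlgebraicGeometry.Scheme.{0})
        (f : X ⟶ (Literature.AlgebraicGeometry.Motives.projectiveSpace n k).left),
        AlgebraicGeometry.IsIntegral X → Function.Surjective f.base →
        (letI := MvPolynomial.gradedAlgebra (σ := Fin (n + 1)) (R := k);
          AlgebraicGeometry.Etale (f ∣_ (AlgebraicGeometry.Proj.basicOpen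
            (MvPolynomial.homogeneousSubmodule (Fin (n + 1)) k) (MvPolynomial.X (Fin.last n))))) →
        Literature.AlgebraicGeometry.Resolution.Scheme.HasResolution X) := by
  intro h
  haveI := isDomain_pinchA (ZMod 2)
  obtain ⟨X, f, hint, hsurj, hopen, hres⟩ :=
    @exists_glued_of_not_hasResolution _ _ _ _ _ (isOpenImmersion_pinchj₁ (ZMod 2))
      (isOpenImmersion_pinchj₂ (ZMod 2)) (isIntegral_projectiveSpace 2 (ZMod 2))
      (isIntegral_Spec_pinch (ZMod 2)) (nonempty_Spec_pinchA (ZMod 2)) _ (pinch_hj (ZMod 2)) _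
      (pinch_preimage_chart_subset_range (ZMod 2)) (not_hasResolution_Spec_pinch (ZMod 2))
  haveI := hopen
  exact hres (h 2 Nat.prime_two (ZMod 2) 2 X f hint hsurj inferInstance)

end Summit.ResolutionOfSingularities.ResolutionOfSingularities.Theorems.CoverResolution.Negative

end
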